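import Literature.AlgebraicGeometry.Frobenioids.PadicFrobenioidPairIsoAlgClosure
import HarnessLib

/-!
# Frobenioids II, Thm. 2.4 (ii): the pair `lim→ K₁^× ≅ lim→ K₂^×` LEVELWISE — `e = B₀(ι_k) ∘ toB0₂ ∘ Ψ_B ∘ toB0₁⁻¹` on
# `K_{Π₁/N_k}^×` — and `ψ̄ : ℚ̄_{p₁}^× ⥲ ℚ̄_{p₂}^×` with every identification exposed

Mochizuki, *The geometry of Frobenioids II*, Kyushu J. Math. **62** (2008) 401–460, §2, proof of Thm. 2.4 (ii), p. 20 l.−5 –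
p. 21 l. 6 [cite: MochizukiFrdII2008, Thm 2.4 (ii) p.21]: "by varying the objects `Aᵢ` and reconstructing the multiplicative group
associated to the field determined by the image of `Aᵢ` … as the groupification of the monoid `O^▷(Aᵢ)` … `Ψ` induces a pair of
compatible isomorphisms `G₁ ⥲ G₂`; `K̄₁^× ⥲ K̄₂^×`".

PROOF-ONLY companion (cell abc-iut, `plan/L1/SUBDAG-FrdII-Thm24.md` row W12-L17, node FrdII:Thm2.4(ii); seat abc-iut-w5-d229).
The W12-L17 files export the pair `e : lim→_k K_{1,Π₁/N_k}^× ≅ lim→_k K_{2,Π₂/N₂,k}^×` only EXISTENTIALLY (abc-iut-w5-d188's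
`exists_fieldUnits_colimit_iso_equivariant`, w5-d194's `exists_pairIso`, w5-d229's `exists_pairIso_topological`), although the
construction is explicit: `e = e₁ ≫ e₂`, `e₁ = colim(toB0₁)⁻¹ ≫ colim(Ψ_B) ≫ colim(toB0₂)` (three `HasColimit.isoOfNatIso`),
`e₂ = colim(B₀(ι))` for the straightening `ι : (Π₁/N_k)_k ⋙ E ≅ (Π₂/N₂,k)_k`.  This file re-runs it KEEPING THE FORMULA, which is
what the Frobenioid-side junctions of Thm. 2.4 (ii) (the orientation bit "`Ψ` preserves `O^▷`", and "`Ψ`'s action on `O^▷(A)` IS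
`ψ̄`" for the Galois-binding closer of abc-iut-w5-d201 / L2-t12) need:
* `exists_pairIso_topological_levelwise` — over ARBITRARY small bases `CosetCat Πᵢ`: `φ : Π₁ ≃ₜ* Π₂`, `N₂`, the straightening
  `ι` reading off `φ` (`r_{φ g} = ι⁻¹ ≫ E(r_g) ≫ ι`), the `φ`-equivariant `e`, AND for every `b ∈ B₁(Π₁/N_k)`:
  `e [toB0₁ b]_k = [B₀(ι_k) (toB0₂ (Ψ_B b))]_k`;
* `exists_pairIso_fbarUnits_levelwise` — at the GENUINE bases (`Πᵢ/U ↦ Spec ℚ̄_{pᵢ}^{Stab}` through open `φᵢ : Πᵢ → G_{ℚ_{pᵢ}}`),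
  with chosen base-point representatives `x_{1,k}`: additionally the descent `ψ : G₁ ≃ₜ* G₂`, the identifications
  `ιᵢ : lim→ ⥲ ℚ̄_{pᵢ}^×` with their legs `a ↦ x_{i,k}⁻¹·a` (`PadicFrobenioidFieldUnitsAlgClosure`), and `ψ̄ = ι₂ ∘ e ∘ ι₁⁻¹`
  compatible with `ψ` (`PadicFrobenioidPairIsoAlgClosure`) — so `ψ̄(x_{1,k}⁻¹·toB0₁ b) = x_{2,k}⁻¹·B₀(ι_k)(toB0₂ (Ψ_B b))` is available
  by rewriting (the field of `d₁.base` at `Π₁/N_k` is read in `ℚ̄_{p₁}` through `hd₁`, an `eqToHom` that is the identity once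
  `d₁.base` is definitionally the genuine base).
Theorems only (no definitions); nothing here bears on [IUTchIII] Cor. 3.12.
-/

noncomputable section

namespace Literature.AlgebraicGeometry.Frobenioids

open CategoryTheory CategoryTheory.Limits Opposite Topology Filter
open Literature.AnabelianGeometry.SemiGraphs

universe u

namespace BaseGaloisSystem

section Levelwise

variable {G : Type u} [Group G] [TopologicalSpace G] [IsTopologicalGroup G] (hG : IsTempered G)
  {G₂ : Type u} [Group G₂] [TopologicalSpace G₂] [IsTopologicalGroup G₂] (hG₂ : IsTempered G₂)
  (N : ℕ → OpenNormalSubgroup G) (hN : Antitone N)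
  {p₁ p₂ : ℕ} [Fact p₁.Prime] [Fact p₂.Prime]
  (d₁ : PadicFrd.Datum (CosetCat G) p₁) (d₂ : PadicFrd.Datum (CosetCat G₂) p₂)

include hG hG₂ in
/-- **[FrdII] Thm. 2.4 (ii), the compatible pair WITH ITS LEVELWISE FORMULA.**  For fieldwise saturated `pᵢ`-adic Frobenioid
data over the small bases `CosetCat Πᵢ`, `E = Ψ^Base` with the row-L02 slot `ΨB : B₁ ≅ E^op ⋙ B₂`, and a cofinal antitone `N`
for `Π₁`: there are `φ : Π₁ ≃ₜ* Π₂`, a cofinal antitone `N₂` with `φ(N_k) = N₂,k`, a STRAIGHTENING `ι : (Π₁/N_k)_k ⋙ E ≅ (Π₂/N₂,k)_k`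
reading off `φ` (`r_{φ g} = ι⁻¹ ≫ E(r_g) ≫ ι`), and a `φ`-equivariant `e : lim→_k K_{1,Π₁/N_k}^× ≅ lim→_k K_{2,Π₂/N₂,k}^×` which
AT LEVEL `k` IS "`toB0₂ ∘ Ψ_B ∘ toB0₁⁻¹` followed by the field map of `ι_k`": for `b ∈ B₁(Π₁/N_k)`,
`e [toB0₁ b]_k = [B₀(ι_k)(toB0₂ (Ψ_B b))]_k` — the reconstruction "`K_{Aᵢ}^× = O^▷(Aᵢ)^gp`, transported by `Ψ`" of the printed
proof, no longer hidden behind an existential. [cite: MochizukiFrdII2008, Thm 2.4 (ii) p.21] -/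
theorem exists_pairIso_topological_levelwise (hfs₁ : d₁.IsFieldwiseSaturated) (hfs₂ : d₂.IsFieldwiseSaturated)
    (E : CosetCat G ≌ CosetCat G₂) (ΨB : d₁.B ≅ E.functor.op ⋙ d₂.B)
    (hNb : ∀ U ∈ 𝓝 (1 : G), ∃ k, (N k : Set G) ⊆ U) :
    haveI := hasColimitsOfShape_nat_commMonCat.{u}
    ∃ (φ : G ≃ₜ* G₂) (N₂ : ℕ → OpenNormalSubgroup G₂) (hN₂ : Antitone N₂)
      (_ : ∀ U ∈ 𝓝 (1 : G₂), ∃ k, (N₂ k : Set G₂) ⊆ U) (_ : ∀ (k : ℕ) (g : G), g ∈ N k ↔ φ g ∈ N₂ k)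
      (ι : cosetSystem N hN ⋙ E.functor.op ≅ cosetSystem N₂ hN₂)
      (e : colimit (cosetSystem N hN ⋙ PadicFrd.bZeroOn d₁.base) ≅
        colimit (cosetSystem N₂ hN₂ ⋙ PadicFrd.bZeroOn d₂.base)),
      (∀ g : G, toAutCoset N₂ hN₂ (φ g) =
        ι.conjAut ((Equivalence.congrRight (E := ℕ) E.op).functor.mapIso (toAutCoset N hN g))) ∧
      (∀ g : G, e.hom ≫ colimMap (Functor.whiskerRight (toAutCoset N₂ hN₂ (φ g)).hom (PadicFrd.bZeroOn d₂.base)) =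
        colimMap (Functor.whiskerRight (toAutCoset N hN g).hom (PadicFrd.bZeroOn d₁.base)) ≫ e.hom) ∧
      ∀ (k : ℕ) (b : d₁.B.obj (op (cQ (N k)))),
        e.hom (colimit.ι (cosetSystem N hN ⋙ PadicFrd.bZeroOn d₁.base) k (d₁.toB0.app (op (cQ (N k))) b)) =
          colimit.ι (cosetSystem N₂ hN₂ ⋙ PadicFrd.bZeroOn d₂.base) k
            ((PadicFrd.bZeroOn d₂.base).map (ι.hom.app k)
              (d₂.toB0.app (op (E.functor.obj (cQ (N k)))) (ΨB.hom.app (op (cQ (N k))) b))) := by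
  haveI := hasColimitsOfShape_nat_commMonCat.{u}
  haveI := d₁.isIso_toB0_of_isFieldwiseSaturated hfs₁
  haveI := d₂.isIso_toB0_of_isFieldwiseSaturated hfs₂
  -- Frobenioid side, EXPLICIT (the construction of abc-iut-w5-d188's `exists_fieldUnits_colimit_iso_equivariant`)
  let W₁ := Functor.isoWhiskerLeft (cosetSystem N hN) (asIso d₁.toB0)
  let W₂ := (Functor.isoWhiskerLeft (cosetSystem N hN) ΨB).trans
    (Functor.associator (cosetSystem N hN) E.functor.op d₂.B).symm
  let W₃ := Functor.isoWhiskerLeft (cosetSystem N hN ⋙ E.functor.op) (asIso d₂.toB0)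
  let e₁ : colimit (cosetSystem N hN ⋙ PadicFrd.bZeroOn d₁.base) ≅
      colimit ((cosetSystem N hN ⋙ E.functor.op) ⋙ PadicFrd.bZeroOn d₂.base) :=
    (HasColimit.isoOfNatIso W₁).symm ≪≫ HasColimit.isoOfNatIso W₂ ≪≫ HasColimit.isoOfNatIso W₃
  have he₁ : ∀ σ : cosetSystem N hN ⟶ cosetSystem N hN,
      e₁.hom ≫ colimMap (Functor.whiskerRight (Functor.whiskerRight σ E.functor.op) (PadicFrd.bZeroOn d₂.base)) =
        colimMap (Functor.whiskerRight σ (PadicFrd.bZeroOn d₁.base)) ≫ e₁.hom := fun σ => by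
    have h₁ := d₁.colimit_toB0_iso_equivariant hfs₁ σ
    have h₂ := d₂.colimit_toB0_iso_equivariant hfs₂ (Functor.whiskerRight σ E.functor.op)
    have h₃ := PadicFrd.colimit_transport_iso_equivariant d₁ d₂ E ΨB σ
    have h₁' : (HasColimit.isoOfNatIso (Functor.isoWhiskerLeft (cosetSystem N hN) (asIso d₁.toB0))).inv ≫
        colimMap (Functor.whiskerRight σ d₁.B) = colimMap (Functor.whiskerRight σ (PadicFrd.bZeroOn d₁.base)) ≫
          (HasColimit.isoOfNatIso (Functor.isoWhiskerLeft (cosetSystem N hN) (asIso d₁.toB0))).inv := by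
      rw [Iso.inv_comp_eq, ← Category.assoc, h₁, Category.assoc, Iso.hom_inv_id, Category.comp_id]
    simp only [e₁, W₁, W₂, W₃, Iso.trans_hom, Iso.symm_hom, Category.assoc]
    rw [h₂, reassoc_of% h₃, reassoc_of% h₁']
  -- base side: straighten the image system, read off `φ` and the levelwise compatibility
  obtain ⟨N₂, hN₂, hN₂b, ι, φ, hφ⟩ := exists_mulEquiv_compatible_of_cosetCat_equivalence hG hG₂ N hN E hNb
  have hlev : ∀ (k : ℕ) (g : G), g ∈ N k ↔ φ g ∈ N₂ k := mem_iff_mem_of_compatible N hN N₂ hN₂ E ι φ hφ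
  obtain ⟨hc, hc'⟩ := continuous_of_levelwise N N₂ φ hNb hN₂b hlev
  let e₂ : colimit ((cosetSystem N hN ⋙ E.functor.op) ⋙ PadicFrd.bZeroOn d₂.base) ≅
      colimit (cosetSystem N₂ hN₂ ⋙ PadicFrd.bZeroOn d₂.base) :=
    HasColimit.isoOfNatIso (Functor.isoWhiskerRight ι (PadicFrd.bZeroOn d₂.base))
  refine ⟨ContinuousMulEquiv.mk φ hc hc', N₂, hN₂, hN₂b, hlev, ι, e₁ ≪≫ e₂, hφ, fun g => ?_, fun k b => ?_⟩
  · have h₂ := colimit_isoOfNatIso_conjAut' ι (PadicFrd.bZeroOn d₂.base)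
      ((Equivalence.congrRight (E := ℕ) E.op).functor.mapIso (toAutCoset N hN g))
    rw [← hφ g] at h₂
    rw [ContinuousMulEquiv.coe_mk, Iso.trans_hom, Category.assoc, h₂, ← Category.assoc, ← Category.assoc]
    congr 1
    exact he₁ (toAutCoset N hN g).hom
  · -- levelwise: chase `toB0₁ b` through the four `isoOfNatIso`s
    have s₁ : (HasColimit.isoOfNatIso W₁).inv
        (colimit.ι (cosetSystem N hN ⋙ PadicFrd.bZeroOn d₁.base) k (d₁.toB0.app (op (cQ (N k))) b)) =
          colimit.ι (cosetSystem N hN ⋙ d₁.B) k b := by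
      have h := HasColimit.isoOfNatIso_ι_hom W₁ k
      have h' : colimit.ι (cosetSystem N hN ⋙ PadicFrd.bZeroOn d₁.base) k (d₁.toB0.app (op (cQ (N k))) b) =
          (HasColimit.isoOfNatIso W₁).hom (colimit.ι (cosetSystem N hN ⋙ d₁.B) k b) := by
        rw [← CommMonCat.comp_apply, h, CommMonCat.comp_apply]
        rfl
      rw [h', ← CommMonCat.comp_apply, Iso.hom_inv_id, CommMonCat.id_apply]
    have s₂ : (HasColimit.isoOfNatIso W₂).hom (colimit.ι (cosetSystem N hN ⋙ d₁.B) k b) =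
        colimit.ι ((cosetSystem N hN ⋙ E.functor.op) ⋙ d₂.B) k (ΨB.hom.app (op (cQ (N k))) b) := by
      rw [← CommMonCat.comp_apply, HasColimit.isoOfNatIso_ι_hom, CommMonCat.comp_apply]
      change colimit.ι ((cosetSystem N hN ⋙ E.functor.op) ⋙ d₂.B) k
        ((ΨB.hom.app (op (cQ (N k))) ≫ 𝟙 _) b) = _
      rw [Category.comp_id]
    have s₃ : (HasColimit.isoOfNatIso W₃).hom
        (colimit.ι ((cosetSystem N hN ⋙ E.functor.op) ⋙ d₂.B) k (ΨB.hom.app (op (cQ (N k))) b)) =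
          colimit.ι ((cosetSystem N hN ⋙ E.functor.op) ⋙ PadicFrd.bZeroOn d₂.base) k
            (d₂.toB0.app (op (E.functor.obj (cQ (N k)))) (ΨB.hom.app (op (cQ (N k))) b)) := by
      rw [← CommMonCat.comp_apply, HasColimit.isoOfNatIso_ι_hom, CommMonCat.comp_apply]
      rfl
    have s₄ : e₂.hom (colimit.ι ((cosetSystem N hN ⋙ E.functor.op) ⋙ PadicFrd.bZeroOn d₂.base) k
        (d₂.toB0.app (op (E.functor.obj (cQ (N k)))) (ΨB.hom.app (op (cQ (N k))) b))) =
          colimit.ι (cosetSystem N₂ hN₂ ⋙ PadicFrd.bZeroOn d₂.base) k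
            ((PadicFrd.bZeroOn d₂.base).map (ι.hom.app k)
              (d₂.toB0.app (op (E.functor.obj (cQ (N k)))) (ΨB.hom.app (op (cQ (N k))) b))) := by
      rw [← CommMonCat.comp_apply, HasColimit.isoOfNatIso_ι_hom, CommMonCat.comp_apply]
      rfl
    change e₂.hom ((HasColimit.isoOfNatIso W₃).hom ((HasColimit.isoOfNatIso W₂).hom ((HasColimit.isoOfNatIso W₁).inv
      (colimit.ι (cosetSystem N hN ⋙ PadicFrd.bZeroOn d₁.base) k (d₁.toB0.app (op (cQ (N k))) b))))) = _
    rw [s₁, s₂, s₃, s₄]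

end Levelwise

/-! ### At the genuine bases: `ψ̄ : ℚ̄_{p₁}^× ⥲ ℚ̄_{p₂}^×` IS `toB0₂ ∘ Ψ_B ∘ toB0₁⁻¹` levelwise, through the straightened
embeddings `a ↦ x_k⁻¹·a` -/

section Genuine

open QuasiTemperoid

variable {p₁ p₂ : ℕ} [Fact p₁.Prime] [Fact p₂.Prime]
  {G : Type} [Group G] [TopologicalSpace G] [IsTopologicalGroup G] (hG : IsTempered G)
  {G₂ : Type} [Group G₂] [TopologicalSpace G₂] [IsTopologicalGroup G₂] (hG₂ : IsTempered G₂)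
  (φ₁ : G →* GalFbar ℚ_[p₁]) (hφ₁ : IsOpenHom φ₁) (φ₂ : G₂ →* GalFbar ℚ_[p₂]) (hφ₂ : IsOpenHom φ₂)
  (N : ℕ → OpenNormalSubgroup G) (hN : Antitone N)
  (d₁ : PadicFrd.Datum (CosetCat G) p₁) (d₂ : PadicFrd.Datum (CosetCat G₂) p₂)

include hG hG₂ in
/-- **[FrdII] Thm. 2.4 (ii): the printed pair ON THE ALGEBRAIC CLOSURES, with EVERY identification exposed.**  Over the
genuine §2 bases and for chosen base-point representatives `x_{i,k}`: `φ : Π₁ ≃ₜ* Π₂` over its descent `ψ : G₁ ≃ₜ* G₂`, a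
cofinal tower `N₂` with `φ(N_k) = N₂,k`, the straightening `ι`, the `φ`-equivariant `e` GIVEN LEVELWISE by
"`toB0₂ ∘ Ψ_B ∘ toB0₁⁻¹` then `B₀(ι_k)`", the identifications `ιᵢ : lim→ ⥲ ℚ̄_{pᵢ}^×` with legs `a ↦ x_{i,k}⁻¹·a`, and
`ψ̄ = ι₂ ∘ e ∘ ι₁⁻¹ : ℚ̄_{p₁}^× ⥲ ℚ̄_{p₂}^×` compatible with `ψ` — so that, for `b ∈ B₁(Π₁/N_k)`,
`ψ̄(x_{1,k}⁻¹ · toB0₁ b) = x_{2,k}⁻¹ · B₀(ι_k)(toB0₂(Ψ_B b))`: "`Ψ`'s action on `O^▷(−)^gp = K^×` IS `ψ̄`" (the link (R1)–(R2) of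
W12's Thm. 2.4 (ii) closer, levelwise).  The field of `d₁.base` at `Π₁/N_k` is read in `ℚ̄_{p₁}` through `hd₁` (`eqToHom`).
[cite: MochizukiFrdII2008, Thm 2.4 (ii) p.21] -/
theorem exists_pairIso_fbarUnits_levelwise
    (hd₁ : d₁.base = CosetCat.push φ₁ hφ₁.isOpenMap ⋙ CosetCat.toConnected (isTempered_galFbar ℚ_[p₁]) ⋙
      galoisPadicFields p₁)
    (hd₂ : d₂.base = CosetCat.push φ₂ hφ₂.isOpenMap ⋙ CosetCat.toConnected (isTempered_galFbar ℚ_[p₂]) ⋙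
      galoisPadicFields p₂)
    (hfs₁ : d₁.IsFieldwiseSaturated) (hfs₂ : d₂.IsFieldwiseSaturated)
    (E : CosetCat G ≌ CosetCat G₂) (ΨB : d₁.B ≅ E.functor.op ⋙ d₂.B)
    (hNb : ∀ U ∈ 𝓝 (1 : G), ∃ k, (N k : Set G) ⊆ U)
    (x₁ : ℕ → GalFbar ℚ_[p₁])
    (hx₁ : ∀ k, (x₁ k : ((CosetCat.push φ₁ hφ₁.isOpenMap).obj (cQ (N k))).carrier) =
      (basePt ((CosetCat.toConnected (isTempered_galFbar ℚ_[p₁])).obj ((CosetCat.push φ₁ hφ₁.isOpenMap).obj (cQ (N k)))) :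
        ((CosetCat.push φ₁ hφ₁.isOpenMap).obj (cQ (N k))).carrier)) :
    haveI := hasColimitsOfShape_nat_commMonCat.{0}
    ∃ (φ : G ≃ₜ* G₂) (ψ : φ₁.range ≃ₜ* φ₂.range) (N₂ : ℕ → OpenNormalSubgroup G₂) (hN₂ : Antitone N₂)
      (_ : ∀ U ∈ 𝓝 (1 : G₂), ∃ k, (N₂ k : Set G₂) ⊆ U) (_ : ∀ (k : ℕ) (g : G), g ∈ N k ↔ φ g ∈ N₂ k)
      (ι : cosetSystem N hN ⋙ E.functor.op ≅ cosetSystem N₂ hN₂)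
      (e : colimit (cosetSystem N hN ⋙ PadicFrd.bZeroOn d₁.base) ≅ colimit (cosetSystem N₂ hN₂ ⋙ PadicFrd.bZeroOn d₂.base))
      (x₂ : ℕ → GalFbar ℚ_[p₂])
      (_ : ∀ k, (x₂ k : ((CosetCat.push φ₂ hφ₂.isOpenMap).obj (cQ (N₂ k))).carrier) =
        (basePt ((CosetCat.toConnected (isTempered_galFbar ℚ_[p₂])).obj ((CosetCat.push φ₂ hφ₂.isOpenMap).obj (cQ (N₂ k)))) :
          ((CosetCat.push φ₂ hφ₂.isOpenMap).obj (cQ (N₂ k))).carrier))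
      (ι₁ : colimit (cosetSystem N hN ⋙ PadicFrd.bZeroOn d₁.base) ≅ CommMonCat.of (Fbar ℚ_[p₁])ˣ)
      (ι₂ : colimit (cosetSystem N₂ hN₂ ⋙ PadicFrd.bZeroOn d₂.base) ≅ CommMonCat.of (Fbar ℚ_[p₂])ˣ)
      (ψbar : (Fbar ℚ_[p₁])ˣ ≃* (Fbar ℚ_[p₂])ˣ),
      -- `φ` over `ψ`
      φ₁.ker.map φ.toMulEquiv.toMonoidHom = φ₂.ker ∧
      (∀ g : G, (ψ ⟨φ₁ g, ⟨g, rfl⟩⟩ : GalFbar ℚ_[p₂]) = φ₂ (φ g)) ∧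
      -- `e` equivariant and LEVELWISE
      (∀ g : G, e.hom ≫ colimMap (Functor.whiskerRight (toAutCoset N₂ hN₂ (φ g)).hom (PadicFrd.bZeroOn d₂.base)) =
        colimMap (Functor.whiskerRight (toAutCoset N hN g).hom (PadicFrd.bZeroOn d₁.base)) ≫ e.hom) ∧
      (∀ (k : ℕ) (b : d₁.B.obj (op (cQ (N k)))),
        e.hom (colimit.ι (cosetSystem N hN ⋙ PadicFrd.bZeroOn d₁.base) k (d₁.toB0.app (op (cQ (N k))) b)) =
          colimit.ι (cosetSystem N₂ hN₂ ⋙ PadicFrd.bZeroOn d₂.base) k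
            ((PadicFrd.bZeroOn d₂.base).map (ι.hom.app k)
              (d₂.toB0.app (op (E.functor.obj (cQ (N k)))) (ΨB.hom.app (op (cQ (N k))) b)))) ∧
      -- the identifications `lim→ = ℚ̄^×`: legs `a ↦ x_k⁻¹ · a`
      (∀ (k : ℕ) (u : (cosetSystem N hN ⋙ PadicFrd.bZeroOn d₁.base).obj k),
        ((ι₁.hom (colimit.ι (cosetSystem N hN ⋙ PadicFrd.bZeroOn d₁.base) k u) : (Fbar ℚ_[p₁])ˣ) : Fbar ℚ_[p₁]) =
          (x₁ k)⁻¹ ((show ↥(fixFld ℚ_[p₁] ((CosetCat.toConnected (isTempered_galFbar ℚ_[p₁])).obj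
              ((CosetCat.push φ₁ hφ₁.isOpenMap).obj (cQ (N k))))) from
            ((eqToHom (congrArg (fun b : CosetCat G ⥤ PadicFrd.PadicFld.{0} p₁ => b.obj (cQ (N k))) hd₁).symm).alg
              (show ((cosetSystem N hN ⋙ PadicFrd.bZeroOn d₁.base).obj k) from u).val)) : Fbar ℚ_[p₁])) ∧
      (∀ (k : ℕ) (u : (cosetSystem N₂ hN₂ ⋙ PadicFrd.bZeroOn d₂.base).obj k),
        ((ι₂.hom (colimit.ι (cosetSystem N₂ hN₂ ⋙ PadicFrd.bZeroOn d₂.base) k u) : (Fbar ℚ_[p₂])ˣ) : Fbar ℚ_[p₂]) =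
          (x₂ k)⁻¹ ((show ↥(fixFld ℚ_[p₂] ((CosetCat.toConnected (isTempered_galFbar ℚ_[p₂])).obj
              ((CosetCat.push φ₂ hφ₂.isOpenMap).obj (cQ (N₂ k))))) from
            ((eqToHom (congrArg (fun b : CosetCat G₂ ⥤ PadicFrd.PadicFld.{0} p₂ => b.obj (cQ (N₂ k))) hd₂).symm).alg
              (show ((cosetSystem N₂ hN₂ ⋙ PadicFrd.bZeroOn d₂.base).obj k) from u).val)) : Fbar ℚ_[p₂])) ∧
      -- `ψ̄ = ι₂ ∘ e ∘ ι₁⁻¹`, compatible with `ψ`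
      (∀ z, ψbar (ι₁.hom z) = ι₂.hom (e.hom z)) ∧
      (∀ (g : G) (u : (Fbar ℚ_[p₁])ˣ),
        ψbar (Units.map ((φ₁ g : GalFbar ℚ_[p₁]) : Fbar ℚ_[p₁] →* Fbar ℚ_[p₁]) u) =
          Units.map ((φ₂ (φ g) : GalFbar ℚ_[p₂]) : Fbar ℚ_[p₂] →* Fbar ℚ_[p₂]) (ψbar u)) ∧
      ∀ (σ : φ₁.range) (u : (Fbar ℚ_[p₁])ˣ),
        ψbar (Units.map ((σ : GalFbar ℚ_[p₁]) : Fbar ℚ_[p₁] →* Fbar ℚ_[p₁]) u) =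
          Units.map (((ψ σ : φ₂.range) : GalFbar ℚ_[p₂]) : Fbar ℚ_[p₂] →* Fbar ℚ_[p₂]) (ψbar u) := by
  haveI := hasColimitsOfShape_nat_commMonCat.{0}
  obtain ⟨base₁, hloc₁, hc₁, he₁, Φ₁, j₁, hj₁, hmono₁, B₁, toB0₁, divB₁, sq₁, cart₁, nz₁⟩ := d₁
  obtain ⟨base₂, hloc₂, hc₂, he₂, Φ₂, j₂, hj₂, hmono₂, B₂, toB0₂, divB₂, sq₂, cart₂, nz₂⟩ := d₂
  cases hd₁
  cases hd₂
  obtain ⟨φ, N₂, hN₂, hN₂b, hlev, ι, e, -, he, hlw⟩ :=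
    exists_pairIso_topological_levelwise hG hG₂ N hN _ _ hfs₁ hfs₂ E ΨB hNb
  obtain ⟨x₂, hx₂⟩ := exists_rep_basePt_seq φ₂ hφ₂ N₂
  obtain ⟨hker, ψ₀, hψ₀⟩ :=
    exists_rangeEquiv_of_equivariant φ₁ hφ₁ φ₂ hφ₂ N hN N₂ hN₂ hNb hN₂b φ.toMulEquiv e he
  obtain ⟨ψ, hψ⟩ := exists_continuousMulEquiv_range φ₁ φ₂ hφ₁.continuous hφ₁.isOpenMap hφ₂.continuous
    hφ₂.isOpenMap φ ψ₀ hψ₀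
  obtain ⟨ι₁, ι₂, ψbar, hleg₁, hleg₂, hfac, hψbar⟩ :=
    exists_fbarUnitsEquiv_of_equivariant_rep φ₁ hφ₁ φ₂ hφ₂ N hN N₂ hN₂ hNb hN₂b x₁ hx₁ x₂ hx₂ φ e he
  refine ⟨φ, ψ, N₂, hN₂, hN₂b, hlev, ι, e, x₂, hx₂, ι₁, ι₂, ψbar, hker, fun g => by rw [hψ]; exact hψ₀ g, he, hlw,
    hleg₁, hleg₂, hfac, hψbar, fun σ u => ?_⟩
  obtain ⟨_, g, rfl⟩ := σ
  rw [hψbar g u, hψ]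
  exact (congrArg (fun s : GalFbar ℚ_[p₂] => Units.map (s : Fbar ℚ_[p₂] →* Fbar ℚ_[p₂]) (ψbar u)) (hψ₀ g)).symm

end Genuine

end BaseGaloisSystem

end Literature.AlgebraicGeometry.Frobenioids

end
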